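import Summits.KontsevichZagierPeriods.Zeta5Search.Barrier.ConeGammaCuspPeriodModulus

/-!
# ζ(5) search — BARRIER: THE FINITE FORMS OF THE MODULUS — signed chamber values (H-side, ≤ 28! chambers) and ray covers (V-side)

HONEST FRAMING (cell `pub-zeta5`): systematic search; no irrationality claim unless kernel-certified. MODEL objects
under Brown–Zudilin's (28)+(30) accounting ([BZ22] = arXiv:2210.03391; (28) observed, not proved); nothing here is a
statement about `ζ(5)`, any `γ` of record, the cone's supremum (C2 OPEN) or the value / sign of the cusp slope, of a
chamber value or of the modulus at a named direction (DATA of the cell); no ray, chamber or value at a named direction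
enters the kernel; S-E stays CONJECTURED; records in print UNMOVED. Prover P2 g36, item «THE GLOBAL ASCENT MODULUS»,
file (3) (theorems only).

THE POINT. File (2)'s modulus `Λ(a,T)` (the least constant in `σ(δ) ≤ Λ·spread(δ)`, attained at a normalised ray) is
a maximum over the normalised rays — a finite set, but one nobody has to enumerate to READ `Λ`: like P2 g35's sign test
it is carried by the cell's two finite data, chamber by chamber (H-side) and ray class by ray class (V-side):
* **`exists_signed_chamber_value`** — THE SIGNED CHAMBER VALUE (any period pattern function `F`, any extension): for a
  generic `δ₀` there is a normalised RAY `x` of its closed chamber with `σ(δ) ≤ σ(x)·spread(δ)` for every `δ` in the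
  chamber — `λ(δ₀) := σ(x)` of EITHER SIGN (file (1)'s section theorem with the chamber weights; `σ = G_{δ₀}` on the
  chamber, P2 g31); P2 g35's chamber ascent value is `max(λ(δ₀), 0)`: `σ ≤ 0 ∨ λ(δ₀)` on the chamber cut to selected
  wall gaps `≤ 1`; `λ(δ₀) < 0` says the chamber DESCENDS STRICTLY, with rate `|λ(δ₀)|` per unit spread;
* **`exists_orderType_rep_modulus_ray`** — H-SIDE FINITE FORM: for ANY set `S` of generic references meeting every
  realised order type (P2 g35: one with `#S ≤ 28!` exists) the modulus ray lies in the closed chamber of a member of `S`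
  — `Λ = max_{δ₁ ∈ S} λ(δ₁)`, a maximum of finitely many signed chamber values;
* **`exists_ray_rep_attaining_modulus`** — V-SIDE FINITE FORM: for ANY set `S` of rays meeting every ray class up to a
  positive gauge (P2 g35's `exists_ray_representatives`) and any normalised `x` carrying the modulus bound, some `y ∈ S`
  attains it: `σ(y) = σ(x)·spread(y)` with `spread(y) > 0` — `Λ = max_{y ∈ S} σ(y)/spread(y)`;
* canonical forms (P2 g33's `F = Σ_b patternN_b`; hpos / hT / hper / hF only).
What stays DATA: the signed chamber values at the four named directions (desk (M1), `HOME/pub-zeta5-p2/g36/alg/`: on P2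
g34/g35's random chambers `λ(δ₀)/T` has median `−0.27 · −0.24 · −0.18 · −0.37` at record/41 · flag/60 · argmax-120 ·
t*/480, every sampled certified chamber descends strictly — none is flat — the least negative at `−0.019 · −0.005 · −0.014
· −0.099`, and `1 · 5 · 2 · 0` sampled chambers ascend); no enumeration of chambers or rays is performed or authorised;
nothing about `γ`, C2, S-E or `ζ(5)`.
-/

noncomputable section

open Set MeasureTheory Finset
open scoped Topology

namespace Summit.KontsevichZagierPeriods.Zeta5Search.Barrier.ConeGamma

/-! ### The signed chamber value -/

/-- **THE SIGNED CHAMBER VALUE SITS AT A NORMALISED RAY** (any period pattern function `F`, any extension). All 28 forms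
of `a` positive, `T > 0` a period, `δ₀` a generic reference. There is a displacement `x` in the closed chamber of `δ₀`,
NORMALISED (rates in `[0, 1]`, one `0`, one `1`) and a RAY (two distinct rates, rigid tie pattern), with
(i) `cuspSlope a T δ ≤ cuspSlope a T x · (r_M(δ) − r_m(δ))` for every `δ` in the closed chamber and every slowest /
fastest pair `(m, M)` of its rates — the signed chamber value `λ(δ₀) := cuspSlope a T x`, OF EITHER SIGN, is the sharp
rate of ascent (or the sharp rate of descent, `λ(δ₀) < 0`) of the chamber per unit spread; and
(ii) `cuspSlope a T δ ≤ max (cuspSlope a T x) 0` for every `δ` in the closed chamber whose selected wall gaps are `≤ 1` —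
P2 g35's chamber ascent value is `max(λ(δ₀), 0)`. (File (1)'s section theorem with the chamber weights, which sum to
`0`; `σ = G_{δ₀}` on the closed chamber.) No value at a named direction is asserted. -/
theorem exists_signed_chamber_value {a : Dir} (hpos : ∀ k, 0 < h28 a k) {T : ℝ} (hT : 0 < T)
    (hper : ∀ k : Fin 28, ∃ z : ℤ, T * h28 a k = z)
    {M : ℕ → Finset (Fin 28)} {f : ℕ → Finset (Fin 28) → ℝ}
    (hf : ∀ m, m + 1 < (bkpts a T).card → ∀ Δ : Fin 8 → ℝ, (∀ k, |phiForm Δ k| < 1) →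
      (∀ k, |phiForm Δ k| < wallDist a T) →
        (torusN (bkpt a T m • sParam a + Δ) : ℝ) = f m ((M m).filter fun k => 0 ≤ phiForm Δ k))
    {F : Finset (Fin 28) → ℝ} (hF : ∀ A, F A = ∑ m ∈ Finset.range ((bkpts a T).card - 1), f m (A ∩ M m))
    {δ₀ : Fin 8 → ℝ} (hgen : ∀ k l : Fin 28, k ≠ l → phiForm δ₀ k / h28 a k ≠ phiForm δ₀ l / h28 a l) :
    ∃ x : Fin 8 → ℝ, (∀ k l : Fin 28, phiForm x k / h28 a k < phiForm x l / h28 a l →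
        phiForm δ₀ k / h28 a k < phiForm δ₀ l / h28 a l) ∧
      (∀ k, 0 ≤ phiForm x k / h28 a k ∧ phiForm x k / h28 a k ≤ 1) ∧
      (∃ k l, phiForm x k / h28 a k = 0 ∧ phiForm x l / h28 a l = 1) ∧
      ((∃ k l, phiForm x k / h28 a k ≠ phiForm x l / h28 a l) ∧
        ∀ d : Fin 8 → ℝ, (∀ k l, phiForm x k / h28 a k = phiForm x l / h28 a l →
          phiForm d k / h28 a k = phiForm d l / h28 a l) → ∃ u t : ℝ, d = u • x + t • sParam a) ∧
      (∀ δ : Fin 8 → ℝ, (∀ k l : Fin 28, phiForm δ k / h28 a k < phiForm δ l / h28 a l →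
          phiForm δ₀ k / h28 a k < phiForm δ₀ l / h28 a l) →
        ∀ m M : Fin 28, (∀ k, phiForm δ m / h28 a m ≤ phiForm δ k / h28 a k ∧
            phiForm δ k / h28 a k ≤ phiForm δ M / h28 a M) →
          cuspSlope a T δ ≤ cuspSlope a T x * (phiForm δ M / h28 a M - phiForm δ m / h28 a m)) ∧
      (∀ δ : Fin 8 → ℝ, (∀ k l : Fin 28, phiForm δ k / h28 a k < phiForm δ l / h28 a l →
          phiForm δ₀ k / h28 a k < phiForm δ₀ l / h28 a l) →
        (∀ k l : Fin 28, phiForm δ₀ k / h28 a k < phiForm δ₀ l / h28 a l →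
          phiForm δ l / h28 a l - phiForm δ k / h28 a k ≤ 1) → cuspSlope a T δ ≤ max (cuspSlope a T x) 0) := by
  obtain ⟨x, hxref, hx01, hxn, hxray, hxmax⟩ :=
    exists_normalised_ray_max_section hpos hgen (period_greedy_sum_eq_zero hpos hT hper hf hF hgen)
  have hloc : ∀ δ : Fin 8 → ℝ, (∀ k l : Fin 28, phiForm δ k / h28 a k < phiForm δ l / h28 a l →
      phiForm δ₀ k / h28 a k < phiForm δ₀ l / h28 a l) →
      ∀ m M : Fin 28, (∀ k, phiForm δ m / h28 a m ≤ phiForm δ k / h28 a k ∧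
        phiForm δ k / h28 a k ≤ phiForm δ M / h28 a M) →
      cuspSlope a T δ ≤ cuspSlope a T x * (phiForm δ M / h28 a M - phiForm δ m / h28 a m) := by
    intro δ href m Mx hmM
    rw [cuspSlope_eq_greedy_period_of_refines hpos hT hper hf hF hgen δ href,
      cuspSlope_eq_greedy_period_of_refines hpos hT hper hf hF hgen x hxref]
    exact hxmax δ href m Mx hmM
  refine ⟨x, hxref, hx01, hxn, hxray, hloc, fun δ href hgap => ?_⟩
  obtain ⟨m, -, hm⟩ := Finset.exists_min_image Finset.univ (fun k => phiForm δ k / h28 a k) Finset.univ_nonempty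
  obtain ⟨Mx, -, hM⟩ := Finset.exists_max_image Finset.univ (fun k => phiForm δ k / h28 a k) Finset.univ_nonempty
  have hmM : ∀ k, phiForm δ m / h28 a m ≤ phiForm δ k / h28 a k ∧ phiForm δ k / h28 a k ≤ phiForm δ Mx / h28 a Mx :=
    fun k => ⟨hm k (Finset.mem_univ _), hM k (Finset.mem_univ _)⟩
  have hs0 : 0 ≤ phiForm δ Mx / h28 a Mx - phiForm δ m / h28 a m := by linarith [(hmM m).2]
  have hs1 : phiForm δ Mx / h28 a Mx - phiForm δ m / h28 a m ≤ 1 := by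
    rcases hs0.eq_or_lt with h | h
    · rw [← h]; exact zero_le_one
    · exact hgap m Mx (href m Mx (by linarith))
  calc cuspSlope a T δ ≤ cuspSlope a T x * (phiForm δ Mx / h28 a Mx - phiForm δ m / h28 a m) := hloc δ href m Mx hmM
    _ ≤ max (cuspSlope a T x) 0 * (phiForm δ Mx / h28 a Mx - phiForm δ m / h28 a m) :=
        mul_le_mul_of_nonneg_right (le_max_left _ _) hs0
    _ ≤ max (cuspSlope a T x) 0 := mul_le_of_le_one_right (le_max_right _ _) hs1

/-! ### H-side: the modulus is the largest of finitely many signed chamber values -/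

/-- **THE MODULUS RAY LIES IN A REPRESENTED CHAMBER — `Λ = max` OF FINITELY MANY SIGNED CHAMBER VALUES** (any period
pattern function `F`, any extension). All 28 forms of `a` positive, `T > 0` a period; `S` any set of generic references
meeting every realised order type (P2 g35's `exists_orderType_representatives`: a finite one with `#S ≤ 28!` exists).
Then some `δ₁ ∈ S` has in its closed chamber a normalised RAY `x` carrying the GLOBAL modulus bound `σ(δ) ≤
σ(x)·(r_M(δ) − r_m(δ))` for every displacement `δ` and every slowest / fastest pair: the global ascent modulus is the
largest signed chamber value over the finitely many members of `S` (each bounded by it). No member of `S` and no value is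
named. -/
theorem exists_orderType_rep_modulus_ray {a : Dir} (hpos : ∀ k, 0 < h28 a k) {T : ℝ} (hT : 0 < T)
    (hper : ∀ k : Fin 28, ∃ z : ℤ, T * h28 a k = z)
    {M : ℕ → Finset (Fin 28)} {f : ℕ → Finset (Fin 28) → ℝ}
    (hf : ∀ m, m + 1 < (bkpts a T).card → ∀ Δ : Fin 8 → ℝ, (∀ k, |phiForm Δ k| < 1) →
      (∀ k, |phiForm Δ k| < wallDist a T) →
        (torusN (bkpt a T m • sParam a + Δ) : ℝ) = f m ((M m).filter fun k => 0 ≤ phiForm Δ k))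
    {F : Finset (Fin 28) → ℝ} (hF : ∀ A, F A = ∑ m ∈ Finset.range ((bkpts a T).card - 1), f m (A ∩ M m))
    {S : Finset (Fin 8 → ℝ)}
    (hS : ∀ δ₀ : Fin 8 → ℝ, (∀ k l : Fin 28, k ≠ l → phiForm δ₀ k / h28 a k ≠ phiForm δ₀ l / h28 a l) →
      ∃ δ₁ ∈ S, ∀ k l, phiForm δ₀ k / h28 a k < phiForm δ₀ l / h28 a l ↔
        phiForm δ₁ k / h28 a k < phiForm δ₁ l / h28 a l) :
    ∃ δ₁ ∈ S, ∃ x : Fin 8 → ℝ, (∀ k l : Fin 28, phiForm x k / h28 a k < phiForm x l / h28 a l →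
        phiForm δ₁ k / h28 a k < phiForm δ₁ l / h28 a l) ∧
      (∀ k, 0 ≤ phiForm x k / h28 a k ∧ phiForm x k / h28 a k ≤ 1) ∧
      (∃ k l, phiForm x k / h28 a k = 0 ∧ phiForm x l / h28 a l = 1) ∧
      ((∃ k l, phiForm x k / h28 a k ≠ phiForm x l / h28 a l) ∧
        ∀ d : Fin 8 → ℝ, (∀ k l, phiForm x k / h28 a k = phiForm x l / h28 a l →
          phiForm d k / h28 a k = phiForm d l / h28 a l) → ∃ u t : ℝ, d = u • x + t • sParam a) ∧
      ∀ δ : Fin 8 → ℝ, ∀ m M : Fin 28, (∀ k, phiForm δ m / h28 a m ≤ phiForm δ k / h28 a k ∧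
          phiForm δ k / h28 a k ≤ phiForm δ M / h28 a M) →
        cuspSlope a T δ ≤ cuspSlope a T x * (phiForm δ M / h28 a M - phiForm δ m / h28 a m) := by
  obtain ⟨x, hx01, hxn, hxray, hmod, -⟩ := exists_modulus_ray hpos hT hper hf hF
  obtain ⟨δ₀, hgen, href⟩ := exists_generic_refines hpos x
  obtain ⟨δ₁, hδ₁, hsame⟩ := hS δ₀ hgen
  exact ⟨δ₁, hδ₁, x, (refines_iff_of_same_order hsame x).mp href, hx01, hxn, hxray, hmod⟩

/-! ### V-side: the modulus is read off any ray cover -/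

/-- **THE MODULUS IS ATTAINED ON ANY RAY COVER — `Λ = max_{y ∈ S} σ(y)/spread(y)`.** All 28 forms of `a` positive, `T > 0`
a period; `S` any set of rays meeting every ray class up to a positive gauge (P2 g35's `exists_ray_representatives`: a
finite one exists); `x` any NORMALISED ray carrying the modulus bound `σ(δ) ≤ σ(x)·spread(δ)` (file (2),
`exists_modulus_ray`). Then some `y ∈ S`, with a slowest / fastest pair `(m, M)` of positive spread, ATTAINS the bound:
`σ(y) = σ(x)·(r_M(y) − r_m(y))` — so `Λ` is the largest of the finitely many normalised slopes `σ(y)/spread(y)`, `y ∈ S`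
(each `≤ Λ` by the bound itself). (`x = u•y + t•s(a)` with `u > 0`; gauge invariance and homogeneity of `σ`, P2 g28.)
No member of `S` and no value is named. -/
theorem exists_ray_rep_attaining_modulus {a : Dir} (hpos : ∀ k, 0 < h28 a k) {T : ℝ} (hT : 0 < T)
    (hper : ∀ k : Fin 28, ∃ z : ℤ, T * h28 a k = z) {S : Finset (Fin 8 → ℝ)}
    (hS : ∀ x : Fin 8 → ℝ, ((∃ k l, phiForm x k / h28 a k ≠ phiForm x l / h28 a l) ∧
        ∀ d : Fin 8 → ℝ, (∀ k l, phiForm x k / h28 a k = phiForm x l / h28 a l →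
          phiForm d k / h28 a k = phiForm d l / h28 a l) → ∃ u t : ℝ, d = u • x + t • sParam a) →
      ∃ y ∈ S, ∃ u t : ℝ, 0 < u ∧ x = u • y + t • sParam a)
    {x : Fin 8 → ℝ} (hx01 : ∀ k, 0 ≤ phiForm x k / h28 a k ∧ phiForm x k / h28 a k ≤ 1)
    (hxn : ∃ k l, phiForm x k / h28 a k = 0 ∧ phiForm x l / h28 a l = 1)
    (hxray : (∃ k l, phiForm x k / h28 a k ≠ phiForm x l / h28 a l) ∧
      ∀ d : Fin 8 → ℝ, (∀ k l, phiForm x k / h28 a k = phiForm x l / h28 a l →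
        phiForm d k / h28 a k = phiForm d l / h28 a l) → ∃ u t : ℝ, d = u • x + t • sParam a) :
    ∃ y ∈ S, ∃ m M : Fin 28, (∀ k, phiForm y m / h28 a m ≤ phiForm y k / h28 a k ∧
        phiForm y k / h28 a k ≤ phiForm y M / h28 a M) ∧
      0 < phiForm y M / h28 a M - phiForm y m / h28 a m ∧
      cuspSlope a T y = cuspSlope a T x * (phiForm y M / h28 a M - phiForm y m / h28 a m) := by
  obtain ⟨y, hy, u, t, hu, hxe⟩ := hS x hxray
  obtain ⟨k₀, l₀, hk₀, hl₀⟩ := hxn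
  -- the rates of `y` from those of `x = u•y + t•s(a)`
  have hr : ∀ k, phiForm y k / h28 a k = u⁻¹ * (phiForm x k / h28 a k - t) := fun k => by
    rw [hxe, rate_smul_add_smul_sParam hpos]; field_simp; ring
  refine ⟨y, hy, k₀, l₀, fun k => ⟨?_, ?_⟩, ?_, ?_⟩
  · rw [hr, hr, hk₀]; exact mul_le_mul_of_nonneg_left (by linarith [(hx01 k).1]) (inv_pos.mpr hu).le
  · rw [hr, hr, hl₀]; exact mul_le_mul_of_nonneg_left (by linarith [(hx01 k).2]) (inv_pos.mpr hu).le
  · rw [hr, hr, hk₀, hl₀, ← mul_sub]; exact mul_pos (inv_pos.mpr hu) (by linarith)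
  · rw [hr, hr, hk₀, hl₀, ← mul_sub, hxe, cuspSlope_smul_add_smul_sParam hpos hT hper y hu t]
    field_simp
    ring

/-! ### Canonical forms -/

/-- **THE SIGNED CHAMBER VALUE — CANONICAL FORM, NO STRUCTURAL HYPOTHESIS** (`F = Σ_m patternN a b_m`, P2 g33; hpos / hT /
hper / hF / hgen only): a normalised ray of the closed chamber of `δ₀` with `σ(δ) ≤ σ(x)·spread(δ)` on the chamber and
`σ ≤ 0 ∨ σ(x)` on the chamber cut to selected wall gaps `≤ 1`. -/
theorem exists_signed_chamber_value_canonical {a : Dir} (hpos : ∀ k, 0 < h28 a k) {T : ℝ} (hT : 0 < T)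
    (hper : ∀ k : Fin 28, ∃ z : ℤ, T * h28 a k = z) {F : Finset (Fin 28) → ℝ}
    (hF : ∀ A, F A = ∑ m ∈ Finset.range ((bkpts a T).card - 1), ((patternN a (bkpt a T m) A : ℤ) : ℝ))
    {δ₀ : Fin 8 → ℝ} (hgen : ∀ k l : Fin 28, k ≠ l → phiForm δ₀ k / h28 a k ≠ phiForm δ₀ l / h28 a l) :
    ∃ x : Fin 8 → ℝ, (∀ k l : Fin 28, phiForm x k / h28 a k < phiForm x l / h28 a l →
        phiForm δ₀ k / h28 a k < phiForm δ₀ l / h28 a l) ∧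
      (∀ k, 0 ≤ phiForm x k / h28 a k ∧ phiForm x k / h28 a k ≤ 1) ∧
      (∃ k l, phiForm x k / h28 a k = 0 ∧ phiForm x l / h28 a l = 1) ∧
      ((∃ k l, phiForm x k / h28 a k ≠ phiForm x l / h28 a l) ∧
        ∀ d : Fin 8 → ℝ, (∀ k l, phiForm x k / h28 a k = phiForm x l / h28 a l →
          phiForm d k / h28 a k = phiForm d l / h28 a l) → ∃ u t : ℝ, d = u • x + t • sParam a) ∧
      (∀ δ : Fin 8 → ℝ, (∀ k l : Fin 28, phiForm δ k / h28 a k < phiForm δ l / h28 a l →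
          phiForm δ₀ k / h28 a k < phiForm δ₀ l / h28 a l) →
        ∀ m M : Fin 28, (∀ k, phiForm δ m / h28 a m ≤ phiForm δ k / h28 a k ∧
            phiForm δ k / h28 a k ≤ phiForm δ M / h28 a M) →
          cuspSlope a T δ ≤ cuspSlope a T x * (phiForm δ M / h28 a M - phiForm δ m / h28 a m)) ∧
      (∀ δ : Fin 8 → ℝ, (∀ k l : Fin 28, phiForm δ k / h28 a k < phiForm δ l / h28 a l →
          phiForm δ₀ k / h28 a k < phiForm δ₀ l / h28 a l) →
        (∀ k l : Fin 28, phiForm δ₀ k / h28 a k < phiForm δ₀ l / h28 a l →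
          phiForm δ l / h28 a l - phiForm δ k / h28 a k ≤ 1) → cuspSlope a T δ ≤ max (cuspSlope a T x) 0) := by
  classical
  exact exists_signed_chamber_value hpos hT hper
    (M := fun m => Finset.univ.filter fun k => ∃ z : ℤ, bkpt a T m * h28 a k = z)
    (f := fun m A => ((patternN a (bkpt a T m) A : ℤ) : ℝ)) (canonical_junction_agreement a T)
    (canonical_period_eq_sum_inter hF) hgen

/-- **`Λ = max` OF FINITELY MANY SIGNED CHAMBER VALUES — CANONICAL FORM** (`F = Σ_m patternN a b_m`; hpos / hT / hper / hF
and the covering set `S` only). -/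
theorem exists_orderType_rep_modulus_ray_canonical {a : Dir} (hpos : ∀ k, 0 < h28 a k) {T : ℝ} (hT : 0 < T)
    (hper : ∀ k : Fin 28, ∃ z : ℤ, T * h28 a k = z) {F : Finset (Fin 28) → ℝ}
    (hF : ∀ A, F A = ∑ m ∈ Finset.range ((bkpts a T).card - 1), ((patternN a (bkpt a T m) A : ℤ) : ℝ))
    {S : Finset (Fin 8 → ℝ)}
    (hS : ∀ δ₀ : Fin 8 → ℝ, (∀ k l : Fin 28, k ≠ l → phiForm δ₀ k / h28 a k ≠ phiForm δ₀ l / h28 a l) →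
      ∃ δ₁ ∈ S, ∀ k l, phiForm δ₀ k / h28 a k < phiForm δ₀ l / h28 a l ↔
        phiForm δ₁ k / h28 a k < phiForm δ₁ l / h28 a l) :
    ∃ δ₁ ∈ S, ∃ x : Fin 8 → ℝ, (∀ k l : Fin 28, phiForm x k / h28 a k < phiForm x l / h28 a l →
        phiForm δ₁ k / h28 a k < phiForm δ₁ l / h28 a l) ∧
      (∀ k, 0 ≤ phiForm x k / h28 a k ∧ phiForm x k / h28 a k ≤ 1) ∧
      (∃ k l, phiForm x k / h28 a k = 0 ∧ phiForm x l / h28 a l = 1) ∧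
      ((∃ k l, phiForm x k / h28 a k ≠ phiForm x l / h28 a l) ∧
        ∀ d : Fin 8 → ℝ, (∀ k l, phiForm x k / h28 a k = phiForm x l / h28 a l →
          phiForm d k / h28 a k = phiForm d l / h28 a l) → ∃ u t : ℝ, d = u • x + t • sParam a) ∧
      ∀ δ : Fin 8 → ℝ, ∀ m M : Fin 28, (∀ k, phiForm δ m / h28 a m ≤ phiForm δ k / h28 a k ∧
          phiForm δ k / h28 a k ≤ phiForm δ M / h28 a M) →
        cuspSlope a T δ ≤ cuspSlope a T x * (phiForm δ M / h28 a M - phiForm δ m / h28 a m) := by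
  classical
  exact exists_orderType_rep_modulus_ray hpos hT hper
    (M := fun m => Finset.univ.filter fun k => ∃ z : ℤ, bkpt a T m * h28 a k = z)
    (f := fun m A => ((patternN a (bkpt a T m) A : ℤ) : ℝ)) (canonical_junction_agreement a T)
    (canonical_period_eq_sum_inter hF) hS

end Summit.KontsevichZagierPeriods.Zeta5Search.Barrier.ConeGamma

end
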